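import Summits.CriticalPhenomena.SAWScalingLimit.Theorems.SAWCompassLatticeSurfaceUniversalityLipPlusIsUnif
import Summits.CriticalPhenomena.SAWScalingLimit.Theorems.SAWCompassLatticeSurfaceUniversalityLipPlusPointIsZ2

/-!
# Objects of the line `registered`, II (reshape v6 by the lead c2) for the crux
# `SAWCompassLattice.SurfaceUniversality` (stmt-CriticalPhenomena-6964): probe-rule discretisations
# of the plus lattice and the statement `LipApproxIndependence`

Route `SAWCompassLattice` (sub-problem `SAWScalingLimit`). Skeleton v5 of the line rests the crux on
`EventualTight` (stmt-1881), the kernel `LipUnifToYB`, and the `ℤ²`-side stub `LipPlusPointIsZ2`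
(`SAW.law` on the sites of `discreteDomainGraph` with site endpoints vs `plusLaw` on the centres of
`meshFaces (π/2)` with port endpoints, bounded-Lipschitz merging), found blocked by worker C of lead
c1 (`Cruxes/SurfaceUniversality/Lines/birth-lipPlusPointIsZ2-analysis.md`). Reshape v6 (lead c2)
derives it from ONE one-model statement plus provable plumbing: the tree's `PortGadget.pathLaw` is
the self-avoiding path law of an ARBITRARY vertex set between ARBITRARY endpoints, and the plus
lattice `plusLattice` (one centre per face, one port per edge) is `ℤ²` with every edge subdivided at
its port, so BOTH laws are — exactly (`plusLaw`, `rfl`) or up to an `O(δ)` redraw (`SAW.law`, the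
site dictionary) — critical plus path laws `plusPathLaw S δ u v` for two vertex sets `S` cut out of
the SAME domain by two LOCAL DISCRETISATION RULES and two pinned endpoint approximations; no
largest-component topology enters (a path law from `u` only sees the component of `u`). Contents
(definitions and `rfl`-level facts only):

* `plusPathLaw S δ u v` (critical `√x_c`-per-half-edge self-avoiding path law of the plus lattice
  through `S`, from `u` to `v`, drawn at mesh `δ`); `plusLaw_eq_plusPathLaw`.
* `ProbeRule`, `probeSupport ρ Ω δ` — a local rule: per vertex kind (centre / vertical port /
  horizontal port) a nonempty list of probes `(K, cl)`, `K ⊆ closedBall 0 2` nonempty; a vertex `v`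
  is kept iff for one of its probes `∀ z ∈ K, δ · (embed v + z) ∈ Ω` (`∈ closure Ω` when `cl`).
  Every vertex at depth `≥ 2δ` is kept, every vertex farther than `2δ` from `closure Ω` dropped.
* `siteRule` (reproduces `meshVertices`/`meshGraph`: a centre iff its west-port point — the mesh
  point of its site — lies in `Ω`, a port iff the closed `ℤ²`-edge it subdivides lies in
  `closure Ω`) and `faceRule` (reproduces `meshFaces (π/2)`: a centre iff its closed square lies in
  `Ω`, a port iff the closed square of one of its two faces does).
* `plusJoinable S` — pairs joined by a self-avoiding plus path through `S`; a PINNED ENDPOINT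
  APPROXIMATION for `ρ` is `u, v : ℝ → PVert` with, eventually, `(u δ, v δ) ∈ plusJoinable
  (probeSupport ρ D.carrier δ)` and `δ · embed (u δ) → D.pt 0`, `δ · embed (v δ) → D.pt 1`.
* `LipApproxIndependence` — THE RESHAPED `ℤ²`-SIDE STATEMENT (`@[conjecture]`, obligation node):
  any two probe rules and any two pinned endpoint approximations of a Dobrushin domain give plus
  path laws merging on bounded Lipschitz test functions as `δ → 0⁺` (independence of the lattice
  approximation, Lawler–Schramm–Werner 2004 §3.4.2, at Lipschitz level, local rules). Contains
  endpoint robustness (stmt-0776 at Lipschitz level) and boundary-layer robustness.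
* `siteFace`, `siteCentre x` — the face / centre whose west port is the site `x`.

Sources: Lawler–Schramm–Werner 2004, §3.4.2 (lattice approximations of `(D; a, b)`); Kennedy–Lawler,
arXiv:1109.3091, §1–2 (lattice effects persist only through boundary-density factors at FREE
endpoints — constants for pinned ones, cancelled by the normalisation: the heuristic behind the
statement); line card `Cruxes/SurfaceUniversality/Lines/birth.md`. NOT here: the stubs as theorems,
the site dictionary, `probeSupport faceRule = faces ∪ their ports`, the composition (skeleton v6).
-/

noncomputable section

namespace Summit.CriticalPhenomena.SAWScalingLimit.Theorems.SurfaceUniversality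

open MeasureTheory Filter Topology Set Metric
open scoped NNReal ENNReal BoundedContinuousFunction
open Literature.Probability.RandomPlanarGeometry
open Literature.Probability.RandomPlanarGeometry.SAW
open Literature.Probability.RandomPlanarGeometry.SAW.YangBaxter
open Literature.Probability.LatticeModels (Site)
open Complex (I)

/-! ### The critical plus-lattice path law through a vertex set -/

/-- **The critical self-avoiding path law of the plus lattice through the vertex set `S`**, from
`u` to `v`, at mesh `δ`: the generic `PortGadget.pathLaw` of `plusLattice` (one centre per face of
the square tiling wired to its four ports = `ℤ²` with every edge subdivided at its port) with
fugacity `√x_c` on every half-edge (so a path through `m` centres between two ports weighs `x_c^m`,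
between two centres `x_c^{m-1}`), drawn by the rescaled straight-line embedding `δ · embed plusPos`
(ports at the integer / half-integer points, centres at the face centres), normalised (junk `0` if
the mass is `0` or `∞`). [folklore] -/
def plusPathLaw (S : Set PVert) (δ : ℝ) (u v : PVert) : Measure (CurveClass ℂ) :=
  PortGadget.pathLaw plusLattice (plusFugacity (Real.sqrt SAW.criticalFugacity))
    (PortGadget.embed plusPos) S δ u v

/-- The plus law of `Ω_δ` between two ports is the plus path law through
`inFaces (meshFaces (π/2) Ω δ)` (all ports, centres of the faces of `Ω_δ`), by `rfl`. [folklore] -/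
theorem plusLaw_eq_plusPathLaw : ∀ (Ω : Set ℂ) (δ : ℝ) (a b : MidEdge), plusLaw Ω δ a b = plusPathLaw (PortGadget.inFaces (meshFaces rightAngles Ω δ)) δ (Sum.inl a) (Sum.inl b) :=
  fun _ _ _ _ => rfl

/-! ### Probe rules -/

/-- **A probe rule** (local discretisation rule of the plus lattice): for each vertex kind — centre,
vertical port (`vert`, subdividing a horizontal `ℤ²`-edge), horizontal port (`slant`, subdividing a
vertical `ℤ²`-edge) — a NONEMPTY finite list of probes `(K, cl)`: a relative test set `K`, nonempty
and bounded (`K ⊆ closedBall 0 2`: probes see only the `2δ`-neighbourhood of their vertex), and a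
flag `cl` (test membership in `closure Ω` rather than in `Ω`). [folklore] -/
structure ProbeRule where
  /-- probes deciding whether a centre is kept -/
  centre : List (Set ℂ × Bool)
  /-- probes deciding whether a vertical port `vert k j` is kept -/
  vport : List (Set ℂ × Bool)
  /-- probes deciding whether a horizontal port `slant k j` is kept -/
  hport : List (Set ℂ × Bool)
  /-- there is at least one centre probe -/
  centre_ne_nil : centre ≠ []
  /-- there is at least one vertical-port probe -/
  vport_ne_nil : vport ≠ []
  /-- there is at least one horizontal-port probe -/
  hport_ne_nil : hport ≠ []
  /-- centre probes are nonempty and bounded -/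
  centre_ok : ∀ p ∈ centre, p.1.Nonempty ∧ p.1 ⊆ closedBall (0 : ℂ) 2
  /-- vertical-port probes are nonempty and bounded -/
  vport_ok : ∀ p ∈ vport, p.1.Nonempty ∧ p.1 ⊆ closedBall (0 : ℂ) 2
  /-- horizontal-port probes are nonempty and bounded -/
  hport_ok : ∀ p ∈ hport, p.1.Nonempty ∧ p.1 ⊆ closedBall (0 : ℂ) 2

namespace ProbeRule

/-- The probes of a rule at a given vertex (by kind). [folklore] -/
def probesAt (ρ : ProbeRule) : PVert → List (Set ℂ × Bool)
  | .inr _ => ρ.centre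
  | .inl (.vert _ _) => ρ.vport
  | .inl (.slant _ _) => ρ.hport

/-- Probes at a centre. [folklore] -/
@[simp] theorem probesAt_inr (ρ : ProbeRule) (f : Face) (u : Unit) :
    ρ.probesAt (.inr (f, u)) = ρ.centre := rfl

/-- Probes at a vertical port. [folklore] -/
@[simp] theorem probesAt_vert (ρ : ProbeRule) (k j : ℤ) :
    ρ.probesAt (.inl (.vert k j)) = ρ.vport := rfl

/-- Probes at a horizontal port. [folklore] -/
@[simp] theorem probesAt_slant (ρ : ProbeRule) (k j : ℤ) :
    ρ.probesAt (.inl (.slant k j)) = ρ.hport := rfl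

/-- There is a probe at every vertex. [folklore] -/
theorem probesAt_ne_nil (ρ : ProbeRule) (v : PVert) : ρ.probesAt v ≠ [] := by
  rcases v with (⟨k, j⟩ | ⟨k, j⟩) | ⟨f, u⟩
  exacts [ρ.vport_ne_nil, ρ.hport_ne_nil, ρ.centre_ne_nil]

/-- Every probe at every vertex is nonempty and bounded. [folklore] -/
theorem probesAt_ok (ρ : ProbeRule) (v : PVert) :
    ∀ p ∈ ρ.probesAt v, p.1.Nonempty ∧ p.1 ⊆ closedBall (0 : ℂ) 2 := by
  rcases v with (⟨k, j⟩ | ⟨k, j⟩) | ⟨f, u⟩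
  exacts [ρ.vport_ok, ρ.hport_ok, ρ.centre_ok]

end ProbeRule

/-- The target of a probe: `closure Ω` for a closed-flag probe, `Ω` itself otherwise. [folklore] -/
def probeTarget (Ω : Set ℂ) : Bool → Set ℂ
  | true => closure Ω
  | false => Ω

/-- `Ω ⊆` either target `⊆ closure Ω`. [folklore] -/
theorem subset_probeTarget_subset (Ω : Set ℂ) (b : Bool) :
    Ω ⊆ probeTarget Ω b ∧ probeTarget Ω b ⊆ closure Ω := by
  cases b
  exacts [⟨Subset.rfl, subset_closure⟩, ⟨subset_closure, Subset.rfl⟩]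

/-- **The vertex set selected by a probe rule** in the domain `Ω` at mesh `δ`: the vertices `v`
PASSING at least one of their probes `p = (K, cl)`, i.e. the rescaled translate of `K` to the vertex
lies in the target: `∀ z ∈ K, δ · (embed v + z) ∈ probeTarget Ω cl`. [folklore] -/
def probeSupport (ρ : ProbeRule) (Ω : Set ℂ) (δ : ℝ) : Set PVert :=
  {v | ∃ p ∈ ρ.probesAt v, ∀ z ∈ p.1, (δ : ℂ) * (PortGadget.embed plusPos v + z) ∈ probeTarget Ω p.2}

/-- Membership in `probeSupport`, unfolded. [folklore] -/
theorem mem_probeSupport_iff {ρ : ProbeRule} {Ω : Set ℂ} {δ : ℝ} {v : PVert} :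
    v ∈ probeSupport ρ Ω δ ↔
      ∃ p ∈ ρ.probesAt v, ∀ z ∈ p.1, (δ : ℂ) * (PortGadget.embed plusPos v + z) ∈ probeTarget Ω p.2 := .rfl

/-- **The pairs of vertices joined by a self-avoiding plus path through `S`** (so that the plus path
law between them through `S` is not the junk measure). [folklore] -/
def plusJoinable (S : Set PVert) : Set (PVert × PVert) :=
  {q | ∃ p : plusLattice.Walk q.1 q.2, p.IsPath ∧ ∀ x ∈ p.support, x ∈ S}

/-- Membership in `plusJoinable`, unfolded. [folklore] -/
theorem mem_plusJoinable_iff {S : Set PVert} {u v : PVert} :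
    (u, v) ∈ plusJoinable S ↔ ∃ p : plusLattice.Walk u v, p.IsPath ∧ ∀ x ∈ p.support, x ∈ S := .rfl

/-! ### The two rules of the line -/

/-- The closed square of the face `(0, 0)` re-centred at its centre:
`{z - 1/2 | z ∈ rhombus (π/2) (0,0)}` (the face `(0, 0)` of the square tiling is
`[0, 1] × [-1/2, 1/2]`, its centre `1/2`). [folklore] -/
def centredSquare : Set ℂ :=
  (fun z => z - (1 / 2 : ℂ)) '' rhombus rightAngles ((0 : ℤ), (0 : ℤ))

/-- A nonempty bounded singleton probe list is fine. [folklore] -/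
theorem probes_ok_singleton {K : Set ℂ} (hK : K.Nonempty) (hK2 : K ⊆ closedBall (0 : ℂ) 2)
    (b : Bool) : ∀ p ∈ [(K, b)], p.1.Nonempty ∧ p.1 ⊆ closedBall (0 : ℂ) 2 := fun p hp => by
  rw [List.mem_singleton] at hp
  subst hp
  exact ⟨hK, hK2⟩

/-- A two-probe list of nonempty bounded probes is fine. [folklore] -/
theorem probes_ok_pair {K K' : Set ℂ} (hK : K.Nonempty) (hK2 : K ⊆ closedBall (0 : ℂ) 2)
    (hK' : K'.Nonempty) (hK'2 : K' ⊆ closedBall (0 : ℂ) 2) (b b' : Bool) :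
    ∀ p ∈ [(K, b), (K', b')], p.1.Nonempty ∧ p.1 ⊆ closedBall (0 : ℂ) 2 := fun p hp => by
  simp only [List.mem_cons, List.not_mem_nil, or_false] at hp
  rcases hp with rfl | rfl
  exacts [⟨hK, hK2⟩, ⟨hK', hK'2⟩]

/-- A point `x + y i` with `|x|, |y| ≤ 1/2` has norm at most `1`. [folklore] -/
theorem norm_le_one_of_abs_le {x y : ℝ} (hx : |x| ≤ 1 / 2) (hy : |y| ≤ 1 / 2) :
    ‖(x : ℂ) + (y : ℂ) * I‖ ≤ 1 := by
  refine (Complex.norm_le_abs_re_add_abs_im _).trans ?_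
  have hre : ((x : ℂ) + (y : ℂ) * I).re = x := by simp
  have him : ((x : ℂ) + (y : ℂ) * I).im = y := by simp
  rw [hre, him]
  linarith

/-- Translating a subset of `closedBall 0 r` by `c` lands in `closedBall 0 (r + ‖c‖)`. [folklore] -/
theorem image_add_const_subset_closedBall {K : Set ℂ} {r : ℝ} (hK : K ⊆ closedBall (0 : ℂ) r)
    (c : ℂ) : (fun z => z + c) '' K ⊆ closedBall (0 : ℂ) (r + ‖c‖) := by
  rintro _ ⟨z, hz, rfl⟩
  have hz' := hK hz
  rw [mem_closedBall, dist_zero_right] at hz' ⊢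
  exact (norm_add_le _ _).trans (by linarith)

/-- The re-centred closed square lies in the closed unit ball (its corners `±1/2 ± i/2` do, and it is
their convex hull). [folklore] -/
theorem centredSquare_subset_closedBall_one : centredSquare ⊆ closedBall (0 : ℂ) 1 := by
  rintro _ ⟨z, hz, rfl⟩
  have h0 : planeCorner rightAngles ((0 : ℤ), (0 : ℤ)) = -(I / 2) := by
    rw [Cruxes.HexTransfer.Sketch.Surface.planeCorner_rightAngles]
    push_cast
    ring
  have hs : colShift rightAngles (0 : ℤ) = 1 :=
    Cruxes.HexTransfer.Sketch.Surface.colShift_rightAngles 0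
  have hcorner : cornerSet rightAngles ((0 : ℤ), (0 : ℤ)) ⊆ closedBall ((1 / 2 : ℂ)) 1 := by
    intro c hc
    simp only [cornerSet, mem_insert_iff, mem_singleton_iff] at hc
    rw [mem_closedBall, Complex.dist_eq]
    have hh : (1 / 2 : ℝ) ≤ 1 / 2 := le_rfl
    have habs : |(1 / 2 : ℝ)| ≤ 1 / 2 := by rw [abs_of_pos (by norm_num)]
    have habs' : |(-(1 / 2) : ℝ)| ≤ 1 / 2 := by rw [abs_neg, abs_of_pos (by norm_num)]
    rcases hc with rfl | rfl | rfl | rfl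
    · rw [h0, show -(I / 2) - (1 / 2 : ℂ) = ((-(1 / 2) : ℝ) : ℂ) + ((-(1 / 2) : ℝ) : ℂ) * I by
        push_cast; ring]
      exact norm_le_one_of_abs_le habs' habs'
    · rw [h0, show -(I / 2) + I - (1 / 2 : ℂ) = ((-(1 / 2) : ℝ) : ℂ) + (((1 / 2) : ℝ) : ℂ) * I by
        push_cast; ring]
      exact norm_le_one_of_abs_le habs' habs
    · rw [h0, hs, show -(I / 2) + 1 - (1 / 2 : ℂ) = (((1 / 2) : ℝ) : ℂ) + ((-(1 / 2) : ℝ) : ℂ) * I by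
        push_cast; ring]
      exact norm_le_one_of_abs_le habs habs'
    · rw [h0, hs, show -(I / 2) + I + 1 - (1 / 2 : ℂ) = (((1 / 2) : ℝ) : ℂ) + (((1 / 2) : ℝ) : ℂ) * I by
        push_cast; ring]
      exact norm_le_one_of_abs_le habs habs
  have hz' : z ∈ closedBall ((1 / 2 : ℂ)) 1 := (convexHull_min hcorner (convex_closedBall _ _)) hz
  rw [mem_closedBall, Complex.dist_eq] at hz'
  rwa [mem_closedBall, dist_zero_right]

/-- The re-centred closed square lies in `closedBall 0 2`. [folklore] -/
theorem centredSquare_subset_closedBall : centredSquare ⊆ closedBall (0 : ℂ) 2 :=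
  centredSquare_subset_closedBall_one.trans (closedBall_subset_closedBall (by norm_num))

/-- A translate of the re-centred square by a vector of norm `≤ 1` lies in `closedBall 0 2`.
[folklore] -/
theorem image_centredSquare_subset_closedBall {c : ℂ} (hc : ‖c‖ ≤ 1) :
    (fun z => z + c) '' centredSquare ⊆ closedBall (0 : ℂ) 2 :=
  (image_add_const_subset_closedBall centredSquare_subset_closedBall_one c).trans
    (closedBall_subset_closedBall (by linarith))

/-- The re-centred closed square is nonempty (it contains the re-centred lower-left corner).
[folklore] -/
theorem centredSquare_nonempty : centredSquare.Nonempty :=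
  ⟨_, planeCorner rightAngles ((0 : ℤ), (0 : ℤ)),
    cornerSet_subset_rhombus _ _ (by simp [cornerSet]), rfl⟩

/-- A segment between two points of the closed ball of radius `2` lies in it. [folklore] -/
theorem segment_subset_closedBall_two {p q : ℂ} (hp : p ∈ closedBall (0 : ℂ) 2)
    (hq : q ∈ closedBall (0 : ℂ) 2) : segment ℝ p q ⊆ closedBall (0 : ℂ) 2 :=
  (convex_closedBall (0 : ℂ) 2).segment_subset hp hq

/-- `‖-1/2 ± i/2‖ ≤ 2`. [folklore] -/
theorem half_corner_mem_closedBall (s : ℝ) (hs : |s| ≤ 1 / 2) :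
    ((-(1 / 2) : ℝ) : ℂ) + (s : ℂ) * I ∈ closedBall (0 : ℂ) 2 := by
  rw [mem_closedBall, dist_zero_right]
  have habs' : |(-(1 / 2) : ℝ)| ≤ 1 / 2 := by rw [abs_neg, abs_of_pos (by norm_num)]
  exact (norm_le_one_of_abs_le habs' hs).trans (by norm_num)

/-- **The site rule**: a centre is kept iff its WEST PORT point lies in `Ω` (the west port
`δ(k + j i)` of the face `(k, j)` is the mesh point of the site `![k, j]`,
`meshPoint_vec_eq_planeMidpoint`); the vertical port `vert k j` (at `k + j i`, subdividing the
`ℤ²`-edge `![k-1, j] — ![k, j]`) iff the closed segment `δ[k - 1 + j i, k + j i]` lies in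
`closure Ω`; the horizontal port `slant k j` (at `k + 1/2 + (j - 1/2) i`, subdividing
`![k, j-1] — ![k, j]`) iff `δ[k + (j-1) i, k + j i] ⊆ closure Ω`. So `probeSupport siteRule Ω δ` is
the canonical site discretisation (`meshVertices Ω δ` with the edges of `meshGraph Ω δ`)
transported to the plus lattice (and drawn shifted by `δ/2`). [folklore] -/
def siteRule : ProbeRule where
  centre := [({-(1 / 2 : ℂ)}, false)]
  vport := [(segment ℝ (-1 : ℂ) 0, true)]
  hport := [(segment ℝ (((-(1 / 2) : ℝ) : ℂ) + ((-(1 / 2) : ℝ) : ℂ) * I)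
    (((-(1 / 2) : ℝ) : ℂ) + (((1 / 2) : ℝ) : ℂ) * I), true)]
  centre_ne_nil := List.cons_ne_nil _ _
  vport_ne_nil := List.cons_ne_nil _ _
  hport_ne_nil := List.cons_ne_nil _ _
  centre_ok := probes_ok_singleton (singleton_nonempty _)
    (by
      rw [singleton_subset_iff, mem_closedBall, dist_zero_right, norm_neg]
      norm_num) _
  vport_ok := probes_ok_singleton ⟨_, left_mem_segment ℝ _ _⟩
    (segment_subset_closedBall_two (by simp) (by simp)) _
  hport_ok := probes_ok_singleton ⟨_, left_mem_segment ℝ _ _⟩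
    (segment_subset_closedBall_two
      (half_corner_mem_closedBall _ (by rw [abs_neg, abs_of_pos (by norm_num)]))
      (half_corner_mem_closedBall _ (by rw [abs_of_pos (by norm_num)]))) _

/-- **The face rule**: a centre is kept iff the closed square of its face lies in `Ω` (i.e. the
face belongs to `meshFaces (π/2) Ω δ`); the vertical port `vert k j` iff the closed square of its
west face `(k-1, j)` or of its east face `(k, j)` lies in `Ω`; the horizontal port `slant k j` iff
the closed square of its south face `(k, j-1)` or of its north face `(k, j)` does. So
`probeSupport faceRule Ω δ` is: the centres of the faces of `Ω_δ` and the ports on their sides.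
[folklore] -/
def faceRule : ProbeRule where
  centre := [(centredSquare, false)]
  vport := [((fun z => z + (-(1 / 2 : ℂ))) '' centredSquare, false),
    ((fun z => z + (1 / 2 : ℂ)) '' centredSquare, false)]
  hport := [((fun z => z + (-(I / 2))) '' centredSquare, false),
    ((fun z => z + I / 2) '' centredSquare, false)]
  centre_ne_nil := List.cons_ne_nil _ _
  vport_ne_nil := List.cons_ne_nil _ _
  hport_ne_nil := List.cons_ne_nil _ _
  centre_ok := probes_ok_singleton centredSquare_nonempty centredSquare_subset_closedBall _
  vport_ok := probes_ok_pair (centredSquare_nonempty.image _)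
    (image_centredSquare_subset_closedBall (by rw [norm_neg]; norm_num))
    (centredSquare_nonempty.image _) (image_centredSquare_subset_closedBall (by norm_num)) _ _
  hport_ok := probes_ok_pair (centredSquare_nonempty.image _)
    (image_centredSquare_subset_closedBall (by rw [norm_neg, norm_div, Complex.norm_I]; norm_num))
    (centredSquare_nonempty.image _)
    (image_centredSquare_subset_closedBall (by rw [norm_div, Complex.norm_I]; norm_num)) _ _

/-! ### Pinned endpoint approximations and the statement -/

/-- STUB STATEMENT `LipApproxIndependence` (**independence of the lattice approximation, at
bounded-Lipschitz level; one model**): for every Dobrushin domain `D`, any two probe rules `ρ, ρ'`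
and any two PINNED ENDPOINT APPROXIMATIONS `(u, v)` for `ρ` and `(u', v')` for `ρ'` — for all small
`δ > 0` the two endpoints are joined by a self-avoiding plus path through the selected vertex set
(`plusJoinable`, so the law is not junk) and their rescaled drawings converge to `D.pt 0`, `D.pt 1`
(as `SAW.IsEndpointApprox` / `IsYBEndpointApprox`, spelled out as three hypotheses each) — the critical
plus-lattice (= subdivided `ℤ²`) self-avoiding path laws through `probeSupport ρ D.carrier δ` from
`u δ` to `v δ` and through `probeSupport ρ' D.carrier δ` from `u' δ` to `v' δ` merge on bounded
LIPSCHITZ test functions of `CurveClass ℂ` as `δ → 0⁺`. The two vertex sets agree with the ideal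
discretisation of `D` off a boundary layer of width `2δ` decided by local rules, and the endpoints
are pinned and `o(1)`-close to the marked points; the statement says neither choice is visible in
the chordal law at Lipschitz level. Instances: `ρ = ρ'` = `siteRule` gives endpoint robustness of
`SAW.law` (item stmt-CriticalPhenomena-0776 at Lipschitz level); `(siteRule, faceRule)` gives the
line's stub `LipPlusPointIsZ2` modulo the site dictionary. OPEN named conjecture of this line
(obligation node, registered stub `stub_lipApproxIndependence` of crux stmt-CriticalPhenomena-6964;
NOT a literature fact — Lawler–Schramm–Werner phrase the scaling-limit conjecture for lattice
approximations of `(D; a, b)` without singling one out; Kennedy–Lawler's persistent lattice effects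
concern FREE boundary endpoints and are multiplicative constants for pinned ones).
[cite: LawlerSchrammWerner2004SAW, §3.4.2 (the boundary-to-boundary measure for lattice approximations of the domain and endpoints; conjectural)]
[cite: KennedyLawler2013, §1–2 (lattice effects in the scaling limit enter through boundary densities at free endpoints)] -/
@[conjecture] def LipApproxIndependence : Prop :=
  ∀ (D : DobrushinDomain) (ρ ρ' : ProbeRule) (u v u' v' : ℝ → PVert),
    (∀ᶠ δ in 𝓝[>] (0 : ℝ), (u δ, v δ) ∈ plusJoinable (probeSupport ρ D.carrier δ)) →
    Tendsto (fun δ : ℝ => (δ : ℂ) * PortGadget.embed plusPos (u δ)) (𝓝[>] (0 : ℝ)) (𝓝 (D.pt 0)) →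
    Tendsto (fun δ : ℝ => (δ : ℂ) * PortGadget.embed plusPos (v δ)) (𝓝[>] (0 : ℝ)) (𝓝 (D.pt 1)) →
    (∀ᶠ δ in 𝓝[>] (0 : ℝ), (u' δ, v' δ) ∈ plusJoinable (probeSupport ρ' D.carrier δ)) →
    Tendsto (fun δ : ℝ => (δ : ℂ) * PortGadget.embed plusPos (u' δ)) (𝓝[>] (0 : ℝ)) (𝓝 (D.pt 0)) →
    Tendsto (fun δ : ℝ => (δ : ℂ) * PortGadget.embed plusPos (v' δ)) (𝓝[>] (0 : ℝ)) (𝓝 (D.pt 1)) →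
    ∀ (f : BoundedContinuousFunction (CurveClass ℂ) ℝ) (L : ℝ≥0), LipschitzWith L f →
      Tendsto (fun δ : ℝ => (∫ x, f x ∂(plusPathLaw (probeSupport ρ D.carrier δ) δ (u δ) (v δ))) -
          ∫ x, f x ∂(plusPathLaw (probeSupport ρ' D.carrier δ) δ (u' δ) (v' δ)))
        (𝓝[>] (0 : ℝ)) (𝓝 0)

/-! ### Sites as centres -/

/-- The face of the square tiling whose WEST PORT is the site `x = ![k, j]`: the face `(k, j)`
(`meshPoint δ ![k, j] = δ · planeMidpoint (π/2) (vert k j)`, `meshPoint_vec_eq_planeMidpoint`). [folklore] -/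
def siteFace (x : Site 2) : Face := (x 0, x 1)

/-- The plus-lattice centre standing for the site `x`: the centre of `siteFace x` (drawn at
`δ(x + 1/2)`, i.e. `δ/2` east of the mesh point of `x`). [folklore] -/
def siteCentre (x : Site 2) : PVert := Sum.inr (siteFace x, ())

/-- `siteCentre` on an explicit vector. [folklore] -/
@[simp] theorem siteCentre_vec (k j : ℤ) : siteCentre ![k, j] = Sum.inr ((k, j), ()) := rfl

/-- `siteFace` is injective (a site is determined by its two coordinates). [folklore] -/
theorem siteFace_injective : Function.Injective siteFace := by
  intro x y h
  simp only [siteFace, Prod.mk.injEq] at h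
  funext i
  fin_cases i
  exacts [h.1, h.2]

/-- `siteCentre` is injective. [folklore] -/
theorem siteCentre_injective : Function.Injective siteCentre := fun x y h =>
  siteFace_injective (by simpa [siteCentre] using h)

/-- `δ · embed (siteCentre x) = meshPoint δ x + δ/2` (the centre is `δ/2` east of the mesh point).
[folklore] -/
theorem embed_siteCentre (δ : ℝ) (x : Site 2) :
    (δ : ℂ) * PortGadget.embed plusPos (siteCentre x) =
      Literature.Probability.LatticeModels.meshPoint δ x + (δ : ℂ) / 2 := by
  have hx : x = ![x 0, x 1] := by funext i; fin_cases i <;> rfl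
  conv_rhs => rw [hx, meshPoint_vec]
  simp only [siteCentre, siteFace, PortGadget.embed, plusPos,
    Cruxes.HexTransfer.Sketch.Surface.planeCorner_rightAngles]
  ring

end Summit.CriticalPhenomena.SAWScalingLimit.Theorems.SurfaceUniversality

end
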